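import Summits.AtomisticToContinuum.HydrodynamicLimit.Theorems.RelayRaceLocalityLightConeInLawSketchLine

/-!
# The open stub of the line `Sketch` IS the crux `LightConeInLaw` (stmt-AtomisticToContinuum-12500)
(line `Sketch`, `--supports`; route `RelayRaceLocality`, sub-problem `HydrodynamicLimit`; lead c2)

Formal certificate for the verdict on the line `Sketch` (registered skeleton
`Cruxes/LightConeInLaw/Lines/Sketch.lean`, rev 8): its one open registered stub `stub_core` — the
positive-time two-copy merging with identified velocity/temperature profiles — is EQUIVALENT to the
route decl `RelayRaceLocality.LightConeInLaw`:

* `core_of_lightConeInLaw : LightConeInLaw → stub_core` — by weakening: the stub is the crux at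
  `0 < t`, `0 < R − c t`, with two extra (unused) identification hypotheses; the crux's inline law of
  large numbers for the comparison gas is the line's `LLNAt` verbatim.
* The converse `stub_core → LightConeInLaw` is the skeleton's composition, in the tree as
  `DoD.lightConeInLaw_of_core` (`…OfHydroLimitGeneral.lean`, p118058: statics stubs 1–3 landed + the
  core as hypothesis); together: `LightConeInLaw ↔ stub_core` (the `Iff` itself is not restated here
  only to keep this file independent of that module).

So the line has transferred everything static (`t = 0` merging, profile identification), every
equilibrium case (rung 0) and everything macroscopic ((DoD) proved; (HL-gen) ⇒ crux conditional)
out of the crux, and what remains registered is the crux itself at positive time: no stub of this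
line is smaller than the item. (Standing disprover, `Cruxes/LightConeInLaw/Disproof.lean` §4, had
recorded `stub_core ⇔ crux` informally; this file makes it a theorem of the tree.) The signature of
`stub_core` below is the registered one, verbatim.
-/

namespace Summit.AtomisticToContinuum.HydrodynamicLimit.Theorems.LightConeInLawSketch.CoreIff

open scoped BigOperators Topology Classical ENNReal
open Filter Set MeasureTheory
open Literature.MathematicalPhysics.KineticTheory Literature.Analysis.FluidPDE

noncomputable section

/-- **The crux implies the line's open stub** (`stub_core` of `Lines/Sketch.lean`, registered
signature verbatim): instantiate the crux at the same data; `0 < t` is weakened to `0 ≤ t`, and the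
hypotheses `0 < R − c t` and the two profile identifications are simply not used. -/
theorem core_of_lightConeInLaw :
    Summit.AtomisticToContinuum.HydrodynamicLimit.Theses.RelayRaceLocality.LightConeInLaw →
    ∃ η₀ : ℝ, 0 < η₀ ∧ ∀ M : ℝ, 0 < M → ∃ c : ℝ, 0 < c ∧
    ∀ (a₁ θ₁ a₂ θ₂ : T3 → ℝ) (u₁ u₂ : T3 → V3), Continuous a₁ → Continuous θ₁ → Continuous u₁ →
      Continuous a₂ → Continuous θ₂ → Continuous u₂ → (∀ x, 0 < a₁ x) → (∀ x, 0 < θ₁ x) →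
      (∀ x, 0 < a₂ x) → (∀ x, 0 < θ₂ x) →
    ∃ σ₀ : ℝ, 0 < σ₀ ∧ ∀ (σ₁ σ₂ : ℝ), 0 < σ₁ → σ₁ < σ₀ → 0 < σ₂ → σ₂ < σ₀ →
    ∀ n₂ : ℕ → ℕ, Tendsto (fun N => (n₂ N : ℝ) * hsDiameter σ₁ N ^ 3) atTop (𝓝 (σ₂ ^ 3)) →
    ∀ (T₁ T₂ : ℝ) (ρ₁ Θ₁ ρ₂ Θ₂ : ℝ → T3 → ℝ) (U₁ U₂ : ℝ → T3 → V3),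
      IsHardSphereEulerSolution σ₁ T₁ ρ₁ U₁ Θ₁ → IsHardSphereEulerSolution σ₂ T₂ ρ₂ U₂ Θ₂ →
    ∀ (Φ₁ : (N : ℕ) → HardSphereFlow G3 (hsDiameter σ₁ N) (N + 1))
      (Φ₂ : (N : ℕ) → HardSphereFlow G3 (hsDiameter σ₁ N) (n₂ N)),
    (∀ N, IsProbabilityMeasure (localGibbsLaw σ₁ a₁ u₁ θ₁ N (Φ₁ N))) →
    (∀ N, IsProbabilityMeasure (particleLaw (Φ₂ N)
      (canonicalDensity G3 (hsDiameter σ₁ N) (n₂ N) (localGibbsProfile a₂ u₂ θ₂)))) →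
    TendstoHydroFieldsAt (fun N => localGibbsLaw σ₁ a₁ u₁ θ₁ N (Φ₁ N)) Φ₁ ρ₁ U₁ Θ₁ 0 →
    LLNAt n₂ (fun N => particleLaw (Φ₂ N)
      (canonicalDensity G3 (hsDiameter σ₁ N) (n₂ N) (localGibbsProfile a₂ u₂ θ₂))) Φ₂
      (ρ₂ 0) (U₂ 0) (Θ₂ 0) 0 →
    (∀ x, U₁ 0 x = u₁ x ∧ Θ₁ 0 x = θ₁ x) → (∀ x, U₂ 0 x = u₂ x ∧ Θ₂ 0 x = θ₂ x) →
    ∀ t : ℝ, 0 < t → t < T₁ → t < T₂ →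
      (∀ s ∈ Set.Icc 0 t, ∀ x, ρ₁ s x * σ₁ ^ 3 < η₀ ∧ Θ₁ s x ≤ M ∧ ‖U₁ s x‖ ≤ M ∧
        ρ₂ s x * σ₂ ^ 3 < η₀ ∧ Θ₂ s x ≤ M ∧ ‖U₂ s x‖ ≤ M) →
    ∀ (x₀ : T3) (R : ℝ), 0 < R - c * t →
      (∀ x, Torus.euclidDist x x₀ < R →
        ρ₁ 0 x * σ₁ ^ 3 = ρ₂ 0 x * σ₂ ^ 3 ∧ U₁ 0 x = U₂ 0 x ∧ Θ₁ 0 x = Θ₂ 0 x) →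
    ∀ χ : T3 → ℝ, Continuous χ → (∀ x, R - c * t ≤ Torus.euclidDist x x₀ → χ x = 0) →
    ∀ F : ℝ × V3 × ℝ → ℝ, LipschitzWith 1 F → (∀ p, |F p| ≤ 1) →
      Tendsto (fun N =>
        (∫ z, F (σ₁ ^ 3 * empiricalDensityField ((Φ₁ N).flow t z) χ,
            (σ₁ ^ 3) • empiricalMomentumField ((Φ₁ N).flow t z) χ,
            σ₁ ^ 3 * empiricalEnergyField ((Φ₁ N).flow t z) χ) ∂(localGibbsLaw σ₁ a₁ u₁ θ₁ N (Φ₁ N))) -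
        ∫ z, F (σ₂ ^ 3 * empiricalDensityField ((Φ₂ N).flow t z) χ,
            (σ₂ ^ 3) • empiricalMomentumField ((Φ₂ N).flow t z) χ,
            σ₂ ^ 3 * empiricalEnergyField ((Φ₂ N).flow t z) χ) ∂(particleLaw (Φ₂ N)
              (canonicalDensity G3 (hsDiameter σ₁ N) (n₂ N) (localGibbsProfile a₂ u₂ θ₂)))) atTop (𝓝 0) := by
  intro h
  obtain ⟨η₀, hη₀, H⟩ := h
  refine ⟨η₀, hη₀, fun M hM => ?_⟩
  obtain ⟨c, hc, Hc⟩ := H M hM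
  refine ⟨c, hc, ?_⟩
  intro a₁ θ₁ a₂ θ₂ u₁ u₂ ha₁ hθ₁ hu₁ ha₂ hθ₂ hu₂ ha₁0 hθ₁0 ha₂0 hθ₂0
  obtain ⟨σ₀, hσ₀, Hσ⟩ := Hc a₁ θ₁ a₂ θ₂ u₁ u₂ ha₁ hθ₁ hu₁ ha₂ hθ₂ hu₂ ha₁0 hθ₁0 ha₂0 hθ₂0
  refine ⟨σ₀, hσ₀, ?_⟩
  intro σ₁ σ₂ hσ₁ hσ₁' hσ₂ hσ₂' n₂ hn₂ T₁ T₂ ρ₁ Θ₁ ρ₂ Θ₂ U₁ U₂ hsol₁ hsol₂ Φ₁ Φ₂ hP₁ hP₂ hL₁ hL₂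
    _hid₁ _hid₂ t ht htT₁ htT₂ hguard x₀ R _hR hagree χ hχ hsupp F hF hFb
  exact Hσ σ₁ σ₂ hσ₁ hσ₁' hσ₂ hσ₂' n₂ hn₂ T₁ T₂ ρ₁ Θ₁ ρ₂ Θ₂ U₁ U₂ hsol₁ hsol₂ Φ₁ Φ₂ hP₁ hP₂ hL₁
    hL₂ t ht.le htT₁ htT₂ hguard x₀ R hagree χ hχ hsupp F hF hFb

end

end Summit.AtomisticToContinuum.HydrodynamicLimit.Theorems.LightConeInLawSketch.CoreIff
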